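import Literature.Probability.LatticeModels.AnnulusManeuver
import HarnessLib

/-!
# The circuit maneuver N-cw: three strip crossings around a northward slit

Topic `Literature/Probability/LatticeModels`; a companion of `AnnulusManeuver.lean` (same steps
`MStep`, same region `mW c k = [c - 48k, c + 48k]²`, same chains `chainM` / `chainN` of
`ManeuverChain.lean`). It is the lattice half of the "crossings of annuli" lemma of D. Chelkak
(Robust discrete complex analysis: a toolbox, Ann. Probab. 44 (2016), Lemma 2.12), in the form
consumed by the corrected boundary-decay lemma (his Lemma 2.14) for the edge-killed walk: the
design N-cw (landing direction within `22.62°` of north, clockwise circuit).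

**The design** (`circNcw`, seven steps, units of `k`, centre `c`). The free simple random walk
started in the box `[20k, 28k] × [14k, 18k]` relative to `c` (`circNcw_start`; more generally in
the first start set `circNcwT c k 0`) performs, with probability at least a universal constant
`circNcwConst > 0` (`circNcwConst_pos`, `circNcwConst_le_chainM`: the free chain `chainM` is at
least `∏ c_i` on the start set), the clockwise circuit "right strip `[12k, 36k] × [-40k, 19k]`
top → bottom (truncated at height `19k`), turn through the bottom-right corner region (two
connectors), bottom strip `[-40k, 46k] × [-36k, -12k]` right → left, turn through the bottom-left
corner region (two connectors), left strip `[-36k, -12k] × [-46k, 19k]` bottom → top (truncated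
at `19k`)", inside `mW c k` (`circNcwU_subset_mW`, `circNcwL_subset_mW`), never entering the
northward slit wedge `{z : z₁ - c₁ ≥ -9k - 1, 12 |z₀ - c₀| ≤ 5 (z₁ - c₁ + 9k) + 13}` nor the box
`{|z₀ - c₀| ≤ 2k, -11k ≤ z₁ - c₁ ≤ -7k}` (`circNcw_avoids`, stated for `k ≥ 5`). The design
checks (`L i ⊆ T (i+1)`, containment in `mW`, landing sets off their open rectangles, avoidance)
are verified by `omega`; the lower bound is the downward induction of `AnnulusManeuver.lean` with
the one-step bound `MStep.lower_bound` (scale-free constants, `exitConst_scale`).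

**The killed chain** (`circNcw_crossings_of_chainN_pos`). If the chain killed on `Sᶜ` (`chainN`)
is positive at a point `x ∈ S` of the first start set with `x₁ ≥ c₁ + 17k`, then `S` contains a
bottom → top crossing of the truncated right strip `[12k, 36k] × [-36k, 17k]`, a left → right
crossing of the bottom strip `[-36k, 36k] × [-36k, -12k]` and a bottom → top crossing of the
truncated left strip `[-36k, -12k] × [-36k, 17k]` (relative to `c`): the walks of steps `0`, `3`
and `6` witnessing positivity (`exists_walk_of_chainN_pos`) are cut down to the slabs by
`exists_subwalk_slab`. Everything is proved.

## References

* D. Chelkak, Robust discrete complex analysis: a toolbox, Ann. Probab. 44 (2016) 628–683,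
  Lemma 2.12 (crossings of annuli) and Lemma 2.14 — bib key `Chelkak2016`.
* S. Smirnov, Ann. of Math. 172 (2010) 1435–1467, App. B (maneuvers of rectangles) — bib key
  `Smirnov2010`.
-/

noncomputable section

namespace Literature.Probability.LatticeModels

open Set SimpleGraph

/-! ### The seven steps -/

/-- **The circuit N-cw** (units of `k`, centre `c`): the clockwise circuit for a northward slit.
From the start set at the top of the right strip go down the right strip `[12, 36] × [-40, 19]`
(truncated at height `19`) and exit through its bottom side, turn through the bottom-right corner
region (two connectors), cross the bottom strip `[-40, 46] × [-36, -12]` right to left, turn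
through the bottom-left corner region (two connectors), and go up the left strip
`[-36, -12] × [-46, 19]` (truncated at `19`), exiting through its top side; all inside
`[-48, 48]²`. Landing sets are middle halves of exit sides, start sets transverse middle thirds,
and each landing set lies in the next start set. [cite: Chelkak2016, Lemma 2.12] -/
def circNcw : Fin 7 → MStep :=
  ![⟨12, -40, 24, 59, 3⟩, ⟨6, -44, 35, 8, 0⟩, ⟨37, -46, 8, 22, 1⟩, ⟨-40, -36, 86, 24, 2⟩,
    ⟨-44, -41, 8, 35, 3⟩, ⟨-46, -45, 22, 8, 0⟩, ⟨-36, -46, 24, 65, 1⟩]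

section Ncw

variable (c : Site 2) (k : ℕ)

/-- Rectangles of the design (empty beyond the last). [folklore] -/
def circNcwU (i : ℕ) : Set (Site 2) := if h : i < 7 then (circNcw ⟨i, h⟩).U c k else ∅

/-- Landing sets of the design. [folklore] -/
def circNcwL (i : ℕ) : Set (Site 2) := if h : i < 7 then (circNcw ⟨i, h⟩).L c k else ∅

/-- Start sets of the design (everything beyond the last). [folklore] -/
def circNcwT (i : ℕ) : Set (Site 2) := if h : i < 7 then (circNcw ⟨i, h⟩).T c k else Set.univ

/-- Step constants. [folklore] -/
def circNcwStepConst (i : ℕ) : ℝ := if h : i < 7 then (circNcw ⟨i, h⟩).const else 1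

/-- The circuit constant `∏ c_i`. [folklore] -/
def circNcwConst : ℝ := ∏ i ∈ Finset.range 7, circNcwStepConst i

/-! ### Design checks -/

/-- The rectangles are finite. [folklore] -/
theorem circNcwU_finite : ∀ i, (circNcwU c k i).Finite := by
  intro i
  unfold circNcwU; split_ifs
  · exact rectInterior_finite _ _ _
  · exact Set.finite_empty

/-- **Design check: each landing set lies in the next start set.** [folklore] -/
theorem circNcwL_subset_T (hk : 0 < k) {i : ℕ} (hi : i < 7) : circNcwL c k i ⊆ circNcwT c k (i + 1) := by
  intro x hx
  interval_cases i <;>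
    simp only [circNcwL, circNcwT, circNcw, MStep.L, MStep.T, MStep.U, MStep.corner, rectInterior,
      Set.mem_setOf_eq, Matrix.cons_val_zero, Matrix.cons_val_one,
      show (6 : ℕ) + 1 < 7 ↔ False by decide, dite_false, Set.mem_univ] at hx ⊢ <;>
    simp at hx ⊢ <;> omega

/-- Start sets lie in their rectangles. [folklore] -/
theorem circNcwT_subset_U {i : ℕ} (hi : i < 7) : circNcwT c k i ⊆ circNcwU c k i := by
  intro x hx
  simp only [circNcwT, circNcwU, dif_pos hi] at hx ⊢
  exact hx.1

/-- **Design check: the rectangles lie in the region `[c - 48k, c + 48k]²`.** [folklore] -/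
theorem circNcwU_subset_mW : ∀ i, circNcwU c k i ⊆ mW c k := by
  intro i x hx
  by_cases hi : i < 7
  · simp only [mW, Set.mem_setOf_eq, abs_le]
    interval_cases i <;>
      simp only [circNcwU, circNcw, MStep.U, MStep.corner, rectInterior,
        Matrix.cons_val_zero, Matrix.cons_val_one] at hx <;>
      simp at hx <;> omega
  · simp [circNcwU, hi] at hx

/-- **Design check: the landing sets lie in the region.** [folklore] -/
theorem circNcwL_subset_mW : 0 < k → ∀ i, circNcwL c k i ⊆ mW c k := by
  intro hk i x hx
  by_cases hi : i < 7
  · simp only [mW, Set.mem_setOf_eq, abs_le]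
    interval_cases i <;>
      simp only [circNcwL, circNcw, MStep.L] at hx <;>
      simp at hx <;> omega
  · simp [circNcwL, hi] at hx

/-- **Design check: landing sets are disjoint from their (open) rectangles.** [folklore] -/
theorem disjoint_circNcwU_L : ∀ i, Disjoint (circNcwU c k i) (circNcwL c k i) := by
  intro i
  rw [Set.disjoint_left]
  intro x hxU hxL
  by_cases hi : i < 7
  · interval_cases i <;>
      simp only [circNcwU, circNcwL, circNcw, MStep.L, MStep.U, MStep.corner, rectInterior,
        Matrix.cons_val_zero, Matrix.cons_val_one] at hxU hxL <;>
      simp at hxU hxL <;> omega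
  · simp [circNcwU, hi] at hxU

/-- **Design check: the start box `[20k, 28k] × [14k, 18k]` (relative to `c`) lies in the first
start set.** [folklore] -/
theorem circNcw_start : 0 < k → ∀ x : Site 2, 20 * k ≤ x 0 - c 0 → x 0 - c 0 ≤ 28 * k → 14 * k ≤ x 1 - c 1 →
    x 1 - c 1 ≤ 18 * k → x ∈ circNcwT c k 0 := by
  intro hk x h0 h0' h1 h1'
  simp only [circNcwT, circNcw, MStep.T, MStep.U, MStep.corner, rectInterior, Set.mem_setOf_eq,
    Matrix.cons_val_zero, Matrix.cons_val_one, show (0 : ℕ) < 7 by decide, dite_true]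
  simp
  omega

/-- **Design check: the circuit avoids the slit wedge and the germ box.** For `k ≥ 5`, every site
of a rectangle or of a landing set of the design lies outside the box
`{|z₀ - c₀| ≤ 2k, -11k ≤ z₁ - c₁ ≤ -7k}` and outside the northward wedge
`{z₁ - c₁ ≥ -9k - 1, 12 |z₀ - c₀| ≤ 5 (z₁ - c₁ + 9k) + 13}` (the slit tip sits at
`c - (0, 9k)`). [folklore] -/
theorem circNcw_avoids : 5 ≤ k → ∀ i, ∀ z ∈ circNcwU c k i ∪ circNcwL c k i,
    (2 * (k : ℤ) < |z 0 - c 0| ∨ z 1 - c 1 < -11 * k ∨ -7 * (k : ℤ) < z 1 - c 1) ∧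
    (z 1 - c 1 < -9 * k - 1 ∨ 5 * (z 1 - c 1 + 9 * k) + 13 < 12 * |z 0 - c 0|) := by
  intro hk i z hz
  by_cases hi : i < 7
  · rcases abs_cases (z 0 - c 0) with ⟨e0, h0⟩ | ⟨e0, h0⟩ <;> rw [e0] <;>
      interval_cases i <;>
        simp only [circNcwU, circNcwL, circNcw, MStep.L, MStep.U, MStep.corner, rectInterior,
          Set.mem_union, Matrix.cons_val_zero, Matrix.cons_val_one] at hz <;>
        simp at hz <;> omega
  · simp [circNcwU, circNcwL, hi] at hz

/-! ### The free chain is bounded below on the start set -/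

/-- The step constants are positive. [folklore] -/
theorem circNcwStepConst_pos (i : ℕ) : 0 < circNcwStepConst i := by
  unfold circNcwStepConst; split_ifs with h
  · apply MStep.const_pos <;> interval_cases i <;> simp [circNcw]
  · exact one_pos

/-- **The circuit constant is positive** (a universal constant). [folklore] -/
theorem circNcwConst_pos : 0 < circNcwConst := Finset.prod_pos fun i _ => circNcwStepConst_pos i

/-- The tail products `∏_{i ≤ j < 7} c_j`. [folklore] -/
def circNcwTailConst (i : ℕ) : ℝ := ∏ j ∈ Finset.Ico i 7, circNcwStepConst j

/-- Tail products are positive. [folklore] -/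
theorem circNcwTailConst_pos (i : ℕ) : 0 < circNcwTailConst i :=
  Finset.prod_pos fun j _ => circNcwStepConst_pos j

/-- `circNcwTailConst i = c_i · circNcwTailConst (i+1)` for `i < 7`. [folklore] -/
theorem circNcwTailConst_succ {i : ℕ} (hi : i < 7) :
    circNcwTailConst i = circNcwStepConst i * circNcwTailConst (i + 1) := by
  unfold circNcwTailConst
  rw [Finset.prod_eq_prod_Ico_succ_bot hi]

/-- **The free chain is at least the tail product on the start sets**: downward induction with
the one-step lower bound `MStep.lower_bound` and the design check `L i ⊆ T (i+1)`. [folklore] -/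
theorem circNcwTailConst_le_chainM (hk : 0 < k) {j : ℕ} (hj : j ≤ 7) {x : Site 2} (hx : x ∈ circNcwT c k (7 - j)) :
    circNcwTailConst (7 - j) ≤ chainM (circNcwU c k) (circNcwL c k) 7 j x := by
  classical
  induction j generalizing x with
  | zero => simp [circNcwTailConst, chainM]
  | succ j ih =>
    have hi : 7 - (j + 1) < 7 := by omega
    set i := 7 - (j + 1) with hidef
    have hi' : 7 - 1 - j = i := by omega
    have hsucc : 7 - j = i + 1 := by omega
    simp only [chainM, hi']
    rw [circNcwTailConst_succ hi]
    -- the data `g = 1_{L i} · M_j`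
    have hM0 : ∀ w, 0 ≤ chainM (circNcwU c k) (circNcwL c k) 7 j w := fun w =>
      (chainM_mem_Icc (circNcwU_finite c k) j w).1
    have hT : ∀ w ∈ circNcwL c k i, circNcwTailConst (i + 1) ≤ chainM (circNcwU c k) (circNcwL c k) 7 j w := by
      intro w hw
      have := ih (by omega) (x := w) (by rw [hsucc]; exact circNcwL_subset_T c k hk hi hw)
      rwa [hsucc] at this
    have key := MStep.lower_bound (circNcw ⟨i, hi⟩) c k hk (by interval_cases i <;> simp [circNcw])
      (by interval_cases i <;> simp [circNcw])
      (g := fun w => if w ∈ circNcwL c k i then chainM (circNcwU c k) (circNcwL c k) 7 j w else 0)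
      (fun w => by split_ifs <;> [exact hM0 w; exact le_rfl]) (circNcwTailConst_pos (i + 1)).le
      (fun w hw => by
        have hw' : w ∈ circNcwL c k i := by simp only [circNcwL, dif_pos hi]; exact hw
        simp only [hw', if_true]; exact hT w hw') (x := x) (by simp only [circNcwT, dif_pos hi] at hx; exact hx)
    rw [mul_comm]
    have hU : (circNcw ⟨i, hi⟩).U c k = circNcwU c k i := by simp only [circNcwU, dif_pos hi]
    have hc : (circNcw ⟨i, hi⟩).const = circNcwStepConst i := by simp only [circNcwStepConst, dif_pos hi]
    rw [hU, hc] at key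
    exact key

/-- **`M ≥ ∏ c_i` on the first start set**: the free walk started in `circNcwT c k 0` (in
particular in the box `[20k, 28k] × [14k, 18k]`, `circNcw_start`) performs the whole circuit with
probability at least `circNcwConst`. [cite: Chelkak2016, Lemma 2.12] -/
theorem circNcwConst_le_chainM : 0 < k → ∀ x ∈ circNcwT c k 0,
    circNcwConst ≤ chainM (circNcwU c k) (circNcwL c k) 7 7 x := by
  intro hk x hx
  have h := circNcwTailConst_le_chainM c k hk le_rfl (x := x) hx
  have e : circNcwTailConst (7 - 7) = circNcwConst := by
    simp only [Nat.sub_self, circNcwTailConst, circNcwConst, Finset.range_eq_Ico]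
  rw [e] at h; exact h

/-! ### A positive killed chain forces three strip crossings inside `S` -/

/-- One step of the killed circuit inside `S` (wrapper of `exists_walk_of_chainN_pos`). [folklore] -/
theorem circNcw_iter_step {S : Set (Site 2)} {i : ℕ} (hi : i < 7) {y : Site 2} (hy : y ∈ circNcwU c k i) (hyS : y ∈ S)
    (hpos : 0 < chainN (circNcwU c k) (circNcwL c k) S 7 (7 - i) y) :
    ∃ y', y' ∈ circNcwL c k i ∧ y' ∈ S ∧ 0 < chainN (circNcwU c k) (circNcwL c k) S 7 (6 - i) y' ∧
      ∃ p : (zdGraph 2).Walk y y', ∀ z ∈ p.support, z ∈ S ∧ (z ∈ circNcwU c k i ∨ z = y') := by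
  have e1 : 7 - 1 - (6 - i) = i := by omega
  have e2 : 7 - i = (6 - i) + 1 := by omega
  rw [e2] at hpos
  have := exists_walk_of_chainN_pos (U := circNcwU c k) (L := circNcwL c k) (S := S) (n := 7)
    (circNcwU_finite c k) (6 - i) (x := y) (by rw [e1]; exact ⟨hy, hyS⟩) hpos
  rw [e1] at this
  exact this

/-- **Three strip crossings in `S`.** If the killed chain of the circuit is positive at a point
`x ∈ S` of the first start set with `x₁ ≥ c₁ + 17k`, then `S` contains a bottom–top crossing of
the truncated right strip `[12k, 36k] × [-36k, 17k]`, a left–right crossing of the bottom strip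
`[-36k, 36k] × [-36k, -12k]` and a bottom–top crossing of the truncated left strip
`[-36k, -12k] × [-36k, 17k]` (all relative to `c`). [cite: Chelkak2016, Lemma 2.12] -/
theorem circNcw_crossings_of_chainN_pos {S : Set (Site 2)} : 0 < k → ∀ x ∈ circNcwT c k 0, x ∈ S →
    c 1 + 17 * k ≤ x 1 → 0 < chainN (circNcwU c k) (circNcwL c k) S 7 7 x →
    (∃ (u v : Site 2) (σ : (zdGraph 2).Walk u v), u 1 = c 1 - 36 * k ∧ v 1 = c 1 + 17 * k ∧
      ∀ z ∈ σ.support, z ∈ S ∧ c 0 + 12 * k ≤ z 0 ∧ z 0 ≤ c 0 + 36 * k ∧ c 1 - 36 * k ≤ z 1 ∧ z 1 ≤ c 1 + 17 * k) ∧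
    (∃ (u v : Site 2) (σ : (zdGraph 2).Walk u v), u 0 = c 0 - 36 * k ∧ v 0 = c 0 + 36 * k ∧
      ∀ z ∈ σ.support, z ∈ S ∧ c 0 - 36 * k ≤ z 0 ∧ z 0 ≤ c 0 + 36 * k ∧ c 1 - 36 * k ≤ z 1 ∧ z 1 ≤ c 1 - 12 * k) ∧
    (∃ (u v : Site 2) (σ : (zdGraph 2).Walk u v), u 1 = c 1 - 36 * k ∧ v 1 = c 1 + 17 * k ∧
      ∀ z ∈ σ.support, z ∈ S ∧ c 0 - 36 * k ≤ z 0 ∧ z 0 ≤ c 0 - 12 * k ∧ c 1 - 36 * k ≤ z 1 ∧ z 1 ≤ c 1 + 17 * k) := by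
  intro hk x hx hxS hx1 hpos
  have hTU : ∀ {i : ℕ} (_ : i + 1 < 7) {y : Site 2}, y ∈ circNcwL c k i → y ∈ circNcwU c k (i + 1) :=
    fun {i} hi {y} hy => circNcwT_subset_U c k hi (circNcwL_subset_T c k hk (by omega) hy)
  -- the seven steps
  have hxU : x ∈ circNcwU c k 0 := circNcwT_subset_U c k (by decide) hx
  obtain ⟨y1, hL1, hS1, hp1, p0, hw0⟩ := circNcw_iter_step c k (by decide : 0 < 7) hxU hxS hpos
  obtain ⟨y2, hL2, hS2, hp2, -⟩ := circNcw_iter_step c k (by decide : 1 < 7) (hTU (by decide) hL1) hS1 hp1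
  obtain ⟨y3, hL3, hS3, hp3, -⟩ := circNcw_iter_step c k (by decide : 2 < 7) (hTU (by decide) hL2) hS2 hp2
  obtain ⟨y4, hL4, hS4, hp4, p3, hw3⟩ := circNcw_iter_step c k (by decide : 3 < 7) (hTU (by decide) hL3) hS3 hp3
  obtain ⟨y5, hL5, hS5, hp5, -⟩ := circNcw_iter_step c k (by decide : 4 < 7) (hTU (by decide) hL4) hS4 hp4
  obtain ⟨y6, hL6, hS6, hp6, -⟩ := circNcw_iter_step c k (by decide : 5 < 7) (hTU (by decide) hL5) hS5 hp5
  obtain ⟨y7, hL7, -, -, p6, hw6⟩ := circNcw_iter_step c k (by decide : 6 < 7) (hTU (by decide) hL6) hS6 hp6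
  -- coordinates of the landing points and of the supports
  simp only [circNcwL, circNcwU, circNcw, MStep.L, MStep.U, MStep.corner, rectInterior, Set.mem_setOf_eq,
    Matrix.cons_val_zero, Matrix.cons_val_one, show (0:ℕ) < 7 by decide, show (2:ℕ) < 7 by decide,
    show (3:ℕ) < 7 by decide, show (5:ℕ) < 7 by decide, show (6:ℕ) < 7 by decide,
    dif_pos] at hL1 hL3 hL4 hL6 hL7 hw0 hw3 hw6
  simp at hL1 hL3 hL4 hL6 hL7 hw0 hw3 hw6
  refine ⟨?_, ?_, ?_⟩
  · -- right strip from `p0 : x → y1`, reversed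
    obtain ⟨u, v, σ, hu, hv, hsub, hσ⟩ := exists_subwalk_slab p0.reverse 1 (L := c 1 - 36 * k) (R := c 1 + 17 * k)
      (by omega) (by omega) (by omega)
    refine ⟨u, v, σ, hu, hv, fun z hz => ?_⟩
    have hz' : z ∈ p0.support := by have := hsub z hz; rwa [Walk.support_reverse, List.mem_reverse] at this
    have h1 := hw0 z hz'; have h2 := hσ z hz
    refine ⟨h1.1, ?_, ?_, h2.1, h2.2⟩ <;> rcases h1.2 with h | rfl <;> omega
  · -- bottom strip from `p3 : y3 → y4`, reversed
    obtain ⟨u, v, σ, hu, hv, hsub, hσ⟩ := exists_subwalk_slab p3.reverse 0 (L := c 0 - 36 * k) (R := c 0 + 36 * k)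
      (by omega) (by omega) (by omega)
    refine ⟨u, v, σ, hu, hv, fun z hz => ?_⟩
    have hz' : z ∈ p3.support := by have := hsub z hz; rwa [Walk.support_reverse, List.mem_reverse] at this
    have h1 := hw3 z hz'; have h2 := hσ z hz
    refine ⟨h1.1, h2.1, h2.2, ?_, ?_⟩ <;> rcases h1.2 with h | rfl <;> omega
  · -- left strip from `p6 : y6 → y7`
    obtain ⟨u, v, σ, hu, hv, hsub, hσ⟩ := exists_subwalk_slab p6 1 (L := c 1 - 36 * k) (R := c 1 + 17 * k)
      (by omega) (by omega) (by omega)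
    refine ⟨u, v, σ, hu, hv, fun z hz => ?_⟩
    have h1 := hw6 z (hsub z hz); have h2 := hσ z hz
    refine ⟨h1.1, ?_, ?_, h2.1, h2.2⟩ <;> rcases h1.2 with h | rfl <;> omega

end Ncw

end Literature.Probability.LatticeModels
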